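import Literature.NumberTheory.Automorphic.SymplecticSimilitudeCartanIwasawaUniqueness
import Literature.NumberTheory.Automorphic.SymplecticHeckeTriangularProducts
import HarnessLib

/-!
# Products of Cartan double cosets of `GSp_{2n}` are unitriangular over ANY commutative coefficient ring
# (Andrianov–Zhuravlev Ch. 3 §3.3; Cartier 1979 §IV, proof of Thm. 4.1 (c), for `G = GSp_{2n}`)

[topic NumberTheory/Automorphic] — lane `lit-hodgefound`, seat p11, generation 43, self-proposed theorem-only row g43-#10
(the `GSp_{2n}` counterpart of `SymplecticHeckeTriangularProducts` (g43-#7) and `HyperspecialUnitaryHeckeTriangularProducts`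
(g43-#4), on top of the multiplicity-one theorem of g43-#9 `SymplecticSimilitudeCartanIwasawaUniqueness`).

## The print

`G = GSp_{2n}(K)`, `K₀ = GSp_{2n}(𝒪)`, Cartan representatives `t(m, a) = diag(ϖ^m ϖ^{a}; ϖ^{-a})` with `a` antitone and
`m + 2aᵢ ≥ 0`, exponents `(a, c)(t(m, a)) = (m + a, m) ∈ ℤⁿ × ℤ`.  Andrianov–Zhuravlev Ch. 3 §3 Lemma 3.6 and §3.3 (the left
cosets of `K₀ t K₀` have triangular representatives whose diagonal is dominated by that of `t`, with the same multiplier;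
the product of two double cosets is the double coset of the product of the representatives plus smaller ones — the
mechanism behind Thm. 3.30); Cartier §IV, proof of Thm. 4.1 (c) («`c(λ, μ) ≠ 0 ⟹ μ ≤ λ`, `c(λ, λ) = δ(λ)^{1/2}`»); Macdonald
Ch. V (2.6).  As in g43-#7 the transform carries TOP terms; here the exponent group is `ℤⁿ × ℤ` and the multiplier
exponent `c` is CONSTANT on a double coset, so the order to control is «`c = m` and `μ ≤ m + a`».  The device of this file:
the injective additive map `ψ : ℤⁿ × ℤ → ℤ^{n+2}`, `(μ, c) ↦ (-c, 2c, -μ)`, under which «`c = m ∧ μ ≤ b`» becomes EXACTLY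
dominance `ψ(b, m) ≤ ψ(μ, c)` of bottoms in `ℤ^{n+2}` (head sums of length `1` and `2` read off `-c` and `c`), so that the
abstract bottom-term lemmas of `GLnSphericalHeckeAlgebraLeadingTerms` §1 / `GLnSphericalHeckeAlgebraIntegralGenerators` §1
apply verbatim through the algebra map `N = R[ψ] = AddMonoidAlgebra.mapDomainAlgHom R R ψ`.

## What is formalised (kernel path: theorems only, no new definitions, no named facts; `ψ` is a closed term)

* §0 `psi_apply_zero/one/succ_succ`, `psi_injective`, **`headSum_psi`**, **`headSum_psi_le_of_lower`** /
  **`lower_of_headSum_psi_le`** (tops `↔` bottoms).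
* §1 `coeff_mapDomain_psi_apply` (`(N f)_{ψ λ} = f_λ`), `exists_eq_psi_of_coeff_mapDomain_ne_zero`,
  `forall_headSum_psi_le_of_coeff_mapDomain_ne_zero`, **`forall_lower_and_coeff_mul_of_top_similitude`** (top data multiply in
  `R[ℤⁿ × ℤ]`).
* §2 `similitudeTorusElt_mul` (`t(m,a) t(m',a') = t(m+m', a+a')`), `similitudeTorusElt_zero`, `dominant_add`, `dominant_list_sum`,
  **`similitudeSatakeTransform_one_top_data`** (top data of `𝒮_1(T_{t(m,a)})`: `c = m`, `μ ≤ m + a`, coefficient `1` — g43-#9).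
* §3 `mem_span_doubleCosetOperator_dominant_similitude` and THE ENGINE
  **`exists_finsupp_eq_sum_of_coeff_similitudeSatakeTransform_one`** (`T = ∑ l_{(m,a)} T_{t(m,a)}` read off the top data of
  `𝒮_1(T)`, leading coefficient `1`, all terms with the same multiplier exponent and dominated).
* §4 PRODUCTS: `similitudeSatakeTransform_one_mul_top_data`, **`exists_finsupp_doubleCosetOperator_mul_eq_sum_similitude`**
  (`T_{t(m,a)} T_{t(m',a')} = ∑_ν l_ν T_{t(ν)}`, `ν = (m + m', b)`, `b ≤ a + a'`, `l_{(m+m', a+a')} = 1`),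
  **`doubleCosetOperator_mul_eq_add_sum_similitude`** (leading term split off),
  **`exists_finsupp_list_prod_doubleCosetOperator_eq_sum_similitude`** (`∏ T_{t(d_j)} = T_{t(Σ d_j)} + lower`).

## References
* [cite: AndrianovZhuravlev1995, Ch. 3 §3 Lemma 3.6; §3.3 (3.44)–(3.46), Thm. 3.30] — A. N. Andrianov, V. G. Zhuravlev, Modular
  forms and Hecke operators, Transl. Math. Monogr. 145, AMS 1995.
* [cite: CartierCorvallis1979, §IV, proof of Thm. 4.1 (c)] — P. Cartier, Representations of p-adic groups: a survey, Proc.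
  Sympos. Pure Math. 33 (1979), part 1, 111–155.
* [cite: Macdonald1995, Ch. I §1; Ch. II (2.3); Ch. V (2.6)] — I. G. Macdonald, Symmetric functions and Hall polynomials, 2nd ed., 1995.
* [cite: BruhatTits1972, §4.4 (4.4.3), Prop. (4.4.4)] — F. Bruhat, J. Tits, Groupes réductifs sur un corps local I, Publ. Math.
  IHÉS 41 (1972).
* [cite: ShimuraIATAF1971, Prop. 3.1] — G. Shimura, Introduction to the arithmetic theory of automorphic functions, 1971.
-/

noncomputable section

open scoped Valued WithZero MatrixGroups
open Matrix MulAction Finset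

namespace Literature.NumberTheory.Automorphic.SymplecticCartan

open Literature.NumberTheory.Automorphic.CartanUnique Literature.NumberTheory.Automorphic.HermitianLattice

variable {K : Type*} [Field K] [Valued K ℤᵐ⁰] {ϖ : K} {n : ℕ} {R : Type*} [CommRing R]

/-! ## §0 The embedding `ψ : ℤⁿ × ℤ → ℤ^{n+2}`, `(μ, c) ↦ (-c, 2c, -μ)` -/

omit [Valued K ℤᵐ⁰] in
/-- `ψ(μ, c)_0 = -c` for the embedding `ψ : ℤⁿ × ℤ → ℤ^{n+2}`, `(μ, c) ↦ (-c, 2c, -μ)` used to turn the tops of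
`R[ℤⁿ × ℤ]` into bottoms of `R[ℤ^{n+2}]`. [cite: Macdonald1995, Ch. V (2.6)] -/
theorem psi_apply_zero (l : (Fin n → ℤ) × ℤ) :
    (LinearMap.pi (Matrix.vecCons (-LinearMap.snd ℤ (Fin n → ℤ) ℤ)
        (Matrix.vecCons ((2 : ℤ) • LinearMap.snd ℤ (Fin n → ℤ) ℤ)
          fun i : Fin n => -((LinearMap.proj i).comp (LinearMap.fst ℤ (Fin n → ℤ) ℤ)))) :
        ((Fin n → ℤ) × ℤ) →ₗ[ℤ] (Fin (n + 2) → ℤ)) l 0 = -l.2 := by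
  rw [LinearMap.pi_apply, Matrix.cons_val_zero, LinearMap.neg_apply, LinearMap.snd_apply]

omit [Valued K ℤᵐ⁰] in
/-- `ψ(μ, c)_1 = 2c`. [cite: Macdonald1995, Ch. V (2.6)] -/
theorem psi_apply_one (l : (Fin n → ℤ) × ℤ) :
    (LinearMap.pi (Matrix.vecCons (-LinearMap.snd ℤ (Fin n → ℤ) ℤ)
        (Matrix.vecCons ((2 : ℤ) • LinearMap.snd ℤ (Fin n → ℤ) ℤ)
          fun i : Fin n => -((LinearMap.proj i).comp (LinearMap.fst ℤ (Fin n → ℤ) ℤ)))) :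
        ((Fin n → ℤ) × ℤ) →ₗ[ℤ] (Fin (n + 2) → ℤ)) l (0 : Fin (n + 1)).succ = 2 * l.2 := by
  rw [LinearMap.pi_apply, Matrix.cons_val_succ, Matrix.cons_val_zero, LinearMap.smul_apply, LinearMap.snd_apply, smul_eq_mul]

omit [Valued K ℤᵐ⁰] in
/-- `ψ(μ, c)_{i+2} = -μ_i`. [cite: Macdonald1995, Ch. V (2.6)] -/
theorem psi_apply_succ_succ (l : (Fin n → ℤ) × ℤ) (i : Fin n) :
    (LinearMap.pi (Matrix.vecCons (-LinearMap.snd ℤ (Fin n → ℤ) ℤ)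
        (Matrix.vecCons ((2 : ℤ) • LinearMap.snd ℤ (Fin n → ℤ) ℤ)
          fun i : Fin n => -((LinearMap.proj i).comp (LinearMap.fst ℤ (Fin n → ℤ) ℤ)))) :
        ((Fin n → ℤ) × ℤ) →ₗ[ℤ] (Fin (n + 2) → ℤ)) l i.succ.succ = -l.1 i := by
  rw [LinearMap.pi_apply, Matrix.cons_val_succ, Matrix.cons_val_succ, LinearMap.neg_apply, LinearMap.comp_apply,
    LinearMap.fst_apply, LinearMap.proj_apply]

omit [Valued K ℤᵐ⁰] in
/-- `ψ` is injective. [cite: Macdonald1995, Ch. V (2.6)] -/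
theorem psi_injective :
    Function.Injective (LinearMap.pi (Matrix.vecCons (-LinearMap.snd ℤ (Fin n → ℤ) ℤ)
        (Matrix.vecCons ((2 : ℤ) • LinearMap.snd ℤ (Fin n → ℤ) ℤ)
          fun i : Fin n => -((LinearMap.proj i).comp (LinearMap.fst ℤ (Fin n → ℤ) ℤ)))) :
        ((Fin n → ℤ) × ℤ) →ₗ[ℤ] (Fin (n + 2) → ℤ)) := by
  intro l l' h
  refine Prod.ext (funext fun i => ?_) ?_
  · have hi := congrFun h i.succ.succ
    rwa [psi_apply_succ_succ, psi_apply_succ_succ, neg_inj] at hi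
  · have h0 := congrFun h 0
    rwa [psi_apply_zero, psi_apply_zero, neg_inj] at h0

omit [Valued K ℤᵐ⁰] in
/-- **Head sums of `ψ(μ, c)`**: `-c·[t>0] + 2c·[t>1] - Σ_{i<t-2} μ_i`. [cite: Macdonald1995, Ch. I §1, Ch. V (2.6)] -/
theorem headSum_psi (l : (Fin n → ℤ) × ℤ) (t : ℕ) :
    (∑ j : Fin (n + 2), if (j : ℕ) < t then (LinearMap.pi (Matrix.vecCons (-LinearMap.snd ℤ (Fin n → ℤ) ℤ)
        (Matrix.vecCons ((2 : ℤ) • LinearMap.snd ℤ (Fin n → ℤ) ℤ)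
          fun i : Fin n => -((LinearMap.proj i).comp (LinearMap.fst ℤ (Fin n → ℤ) ℤ)))) :
        ((Fin n → ℤ) × ℤ) →ₗ[ℤ] (Fin (n + 2) → ℤ)) l j else 0) =
      (if 0 < t then -l.2 else 0) + (if 1 < t then 2 * l.2 else 0) - ∑ i : Fin n, if (i : ℕ) < t - 2 then l.1 i else 0 := by
  rw [Fin.sum_univ_succ, Fin.sum_univ_succ, psi_apply_zero, Fin.val_zero]
  simp only [psi_apply_one, psi_apply_succ_succ, Fin.val_succ, Fin.val_zero, zero_add]
  have h : (∑ i : Fin n, if (i : ℕ) + 1 + 1 < t then -l.1 i else 0) = -∑ i : Fin n, if (i : ℕ) < t - 2 then l.1 i else 0 := by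
    rw [← Finset.sum_neg_distrib]
    refine Finset.sum_congr rfl fun i _ => ?_
    by_cases hi : (i : ℕ) < t - 2
    · rw [if_pos (by omega), if_pos hi]
    · rw [if_neg (by omega), if_neg hi, neg_zero]
  rw [h]
  ring

omit [Valued K ℤᵐ⁰] in
/-- **Tops become bottoms under `ψ`**: `c = m` and `μ ≤ b` (dominance) give `ψ(b, m) ≤ ψ(μ, c)` (dominance in `ℤ^{n+2}`).
[cite: Macdonald1995, Ch. V (2.6)] [cite: CartierCorvallis1979, §IV, proof of Thm. 4.1 (c)] -/
theorem headSum_psi_le_of_lower {μc : (Fin n → ℤ) × ℤ} {b : Fin n → ℤ} {m : ℤ} (hc : μc.2 = m)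
    (hle : ∀ s : ℕ, (∑ i : Fin n, if (i : ℕ) < s then μc.1 i else 0) ≤ ∑ i : Fin n, if (i : ℕ) < s then b i else 0)
    (t : ℕ) :
    (∑ j : Fin (n + 2), if (j : ℕ) < t then (LinearMap.pi (Matrix.vecCons (-LinearMap.snd ℤ (Fin n → ℤ) ℤ)
        (Matrix.vecCons ((2 : ℤ) • LinearMap.snd ℤ (Fin n → ℤ) ℤ)
          fun i : Fin n => -((LinearMap.proj i).comp (LinearMap.fst ℤ (Fin n → ℤ) ℤ)))) :
        ((Fin n → ℤ) × ℤ) →ₗ[ℤ] (Fin (n + 2) → ℤ)) (b, m) j else 0) ≤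
      ∑ j : Fin (n + 2), if (j : ℕ) < t then (LinearMap.pi (Matrix.vecCons (-LinearMap.snd ℤ (Fin n → ℤ) ℤ)
        (Matrix.vecCons ((2 : ℤ) • LinearMap.snd ℤ (Fin n → ℤ) ℤ)
          fun i : Fin n => -((LinearMap.proj i).comp (LinearMap.fst ℤ (Fin n → ℤ) ℤ)))) :
        ((Fin n → ℤ) × ℤ) →ₗ[ℤ] (Fin (n + 2) → ℤ)) μc j else 0 := by
  rw [headSum_psi, headSum_psi, hc]
  have h := hle (t - 2)
  simp only
  linarith

omit [Valued K ℤᵐ⁰] in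
/-- **… and back**: `ψ(b, m) ≤ ψ(μ, c)` forces `c = m` (head sums of lengths `1` and `2`) and `μ ≤ b`.
[cite: Macdonald1995, Ch. V (2.6)] [cite: CartierCorvallis1979, §IV, proof of Thm. 4.1 (c)] -/
theorem lower_of_headSum_psi_le {μc : (Fin n → ℤ) × ℤ} {b : Fin n → ℤ} {m : ℤ}
    (h : ∀ t : ℕ, (∑ j : Fin (n + 2), if (j : ℕ) < t then (LinearMap.pi (Matrix.vecCons (-LinearMap.snd ℤ (Fin n → ℤ) ℤ)
        (Matrix.vecCons ((2 : ℤ) • LinearMap.snd ℤ (Fin n → ℤ) ℤ)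
          fun i : Fin n => -((LinearMap.proj i).comp (LinearMap.fst ℤ (Fin n → ℤ) ℤ)))) :
        ((Fin n → ℤ) × ℤ) →ₗ[ℤ] (Fin (n + 2) → ℤ)) (b, m) j else 0) ≤
      ∑ j : Fin (n + 2), if (j : ℕ) < t then (LinearMap.pi (Matrix.vecCons (-LinearMap.snd ℤ (Fin n → ℤ) ℤ)
        (Matrix.vecCons ((2 : ℤ) • LinearMap.snd ℤ (Fin n → ℤ) ℤ)
          fun i : Fin n => -((LinearMap.proj i).comp (LinearMap.fst ℤ (Fin n → ℤ) ℤ)))) :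
        ((Fin n → ℤ) × ℤ) →ₗ[ℤ] (Fin (n + 2) → ℤ)) μc j else 0) :
    μc.2 = m ∧ ∀ s : ℕ, (∑ i : Fin n, if (i : ℕ) < s then μc.1 i else 0) ≤ ∑ i : Fin n, if (i : ℕ) < s then b i else 0 := by
  have h1 := h 1
  have h2 := h 2
  rw [headSum_psi, headSum_psi] at h1 h2
  have h0 : ∀ f : Fin n → ℤ, (∑ i : Fin n, if (i : ℕ) < 0 then f i else 0) = 0 := fun f =>
    Finset.sum_eq_zero fun i _ => if_neg (Nat.not_lt_zero _)
  simp only [Nat.lt_irrefl, if_false, if_true, Nat.one_lt_two, Nat.zero_lt_one, Nat.zero_lt_two,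
    show (1 : ℕ) - 2 = 0 from rfl, h0, sub_zero, add_zero] at h1 h2
  have hc : μc.2 = m := by linarith
  refine ⟨hc, fun s => ?_⟩
  have hs := h (s + 2)
  rw [headSum_psi, headSum_psi, hc, Nat.add_sub_cancel] at hs
  simp only [Nat.succ_pos', if_true, show 1 < s + 2 by omega] at hs
  linarith

/-! ## §1 The twist `N = R[ψ]` and top data -/

omit [Valued K ℤᵐ⁰] in
/-- `(N f)_{ψ(λ)} = f_λ` for the twist `N = R[ψ] : R[ℤⁿ × ℤ] → R[ℤ^{n+2}]`. [cite: Macdonald1995, Ch. V (2.6)] -/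
theorem coeff_mapDomain_psi_apply (f : AddMonoidAlgebra R ((Fin n → ℤ) × ℤ)) (l : (Fin n → ℤ) × ℤ) :
    (AddMonoidAlgebra.mapDomainAlgHom R R (LinearMap.pi (Matrix.vecCons (-LinearMap.snd ℤ (Fin n → ℤ) ℤ)
        (Matrix.vecCons ((2 : ℤ) • LinearMap.snd ℤ (Fin n → ℤ) ℤ)
          fun i : Fin n => -((LinearMap.proj i).comp (LinearMap.fst ℤ (Fin n → ℤ) ℤ)))) :
        ((Fin n → ℤ) × ℤ) →ₗ[ℤ] (Fin (n + 2) → ℤ)).toAddMonoidHom f).coeff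
      ((LinearMap.pi (Matrix.vecCons (-LinearMap.snd ℤ (Fin n → ℤ) ℤ)
        (Matrix.vecCons ((2 : ℤ) • LinearMap.snd ℤ (Fin n → ℤ) ℤ)
          fun i : Fin n => -((LinearMap.proj i).comp (LinearMap.fst ℤ (Fin n → ℤ) ℤ)))) :
        ((Fin n → ℤ) × ℤ) →ₗ[ℤ] (Fin (n + 2) → ℤ)) l) = f.coeff l := by
  rw [AddMonoidAlgebra.mapDomainAlgHom_apply, AddMonoidAlgebra.coeff_mapDomain, LinearMap.toAddMonoidHom_coe,
    Finsupp.mapDomain_apply psi_injective]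

omit [Valued K ℤᵐ⁰] in
/-- The exponents of `N f` are the `ψ(λ)`, `λ` an exponent of `f`. [cite: Macdonald1995, Ch. V (2.6)] -/
theorem exists_eq_psi_of_coeff_mapDomain_ne_zero {f : AddMonoidAlgebra R ((Fin n → ℤ) × ℤ)} {v : Fin (n + 2) → ℤ}
    (hv : (AddMonoidAlgebra.mapDomainAlgHom R R (LinearMap.pi (Matrix.vecCons (-LinearMap.snd ℤ (Fin n → ℤ) ℤ)
        (Matrix.vecCons ((2 : ℤ) • LinearMap.snd ℤ (Fin n → ℤ) ℤ)
          fun i : Fin n => -((LinearMap.proj i).comp (LinearMap.fst ℤ (Fin n → ℤ) ℤ)))) :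
        ((Fin n → ℤ) × ℤ) →ₗ[ℤ] (Fin (n + 2) → ℤ)).toAddMonoidHom f).coeff v ≠ 0) :
    ∃ l : (Fin n → ℤ) × ℤ, (LinearMap.pi (Matrix.vecCons (-LinearMap.snd ℤ (Fin n → ℤ) ℤ)
        (Matrix.vecCons ((2 : ℤ) • LinearMap.snd ℤ (Fin n → ℤ) ℤ)
          fun i : Fin n => -((LinearMap.proj i).comp (LinearMap.fst ℤ (Fin n → ℤ) ℤ)))) :
        ((Fin n → ℤ) × ℤ) →ₗ[ℤ] (Fin (n + 2) → ℤ)) l = v ∧ f.coeff l ≠ 0 := by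
  by_cases hmem : v ∈ Set.range (LinearMap.pi (Matrix.vecCons (-LinearMap.snd ℤ (Fin n → ℤ) ℤ)
        (Matrix.vecCons ((2 : ℤ) • LinearMap.snd ℤ (Fin n → ℤ) ℤ)
          fun i : Fin n => -((LinearMap.proj i).comp (LinearMap.fst ℤ (Fin n → ℤ) ℤ)))) :
        ((Fin n → ℤ) × ℤ) →ₗ[ℤ] (Fin (n + 2) → ℤ))
  · obtain ⟨l, rfl⟩ := hmem
    rw [coeff_mapDomain_psi_apply] at hv
    exact ⟨l, rfl, hv⟩
  · refine absurd ?_ hv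
    rw [AddMonoidAlgebra.mapDomainAlgHom_apply, AddMonoidAlgebra.coeff_mapDomain, LinearMap.toAddMonoidHom_coe]
    exact Finsupp.mapDomain_notin_range _ _ hmem

omit [Valued K ℤᵐ⁰] in
/-- **Tops of `f` in `R[ℤⁿ × ℤ]` (multiplier exponent `m`, dominance-below `b`) become bottoms `ψ(b, m)` of `N f`.**
[cite: Macdonald1995, Ch. V (2.6)] [cite: CartierCorvallis1979, §IV, proof of Thm. 4.1 (c)] -/
theorem forall_headSum_psi_le_of_coeff_mapDomain_ne_zero {f : AddMonoidAlgebra R ((Fin n → ℤ) × ℤ)} {b : Fin n → ℤ} {m : ℤ}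
    (hf : ∀ μc, f.coeff μc ≠ 0 → μc.2 = m ∧
      ∀ s : ℕ, (∑ i : Fin n, if (i : ℕ) < s then μc.1 i else 0) ≤ ∑ i : Fin n, if (i : ℕ) < s then b i else 0)
    (v : Fin (n + 2) → ℤ)
    (hv : (AddMonoidAlgebra.mapDomainAlgHom R R (LinearMap.pi (Matrix.vecCons (-LinearMap.snd ℤ (Fin n → ℤ) ℤ)
        (Matrix.vecCons ((2 : ℤ) • LinearMap.snd ℤ (Fin n → ℤ) ℤ)
          fun i : Fin n => -((LinearMap.proj i).comp (LinearMap.fst ℤ (Fin n → ℤ) ℤ)))) :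
        ((Fin n → ℤ) × ℤ) →ₗ[ℤ] (Fin (n + 2) → ℤ)).toAddMonoidHom f).coeff v ≠ 0) (t : ℕ) :
    (∑ j : Fin (n + 2), if (j : ℕ) < t then (LinearMap.pi (Matrix.vecCons (-LinearMap.snd ℤ (Fin n → ℤ) ℤ)
        (Matrix.vecCons ((2 : ℤ) • LinearMap.snd ℤ (Fin n → ℤ) ℤ)
          fun i : Fin n => -((LinearMap.proj i).comp (LinearMap.fst ℤ (Fin n → ℤ) ℤ)))) :
        ((Fin n → ℤ) × ℤ) →ₗ[ℤ] (Fin (n + 2) → ℤ)) (b, m) j else 0) ≤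
      ∑ j : Fin (n + 2), if (j : ℕ) < t then v j else 0 := by
  obtain ⟨l, rfl, hl⟩ := exists_eq_psi_of_coeff_mapDomain_ne_zero hv
  obtain ⟨hc, hle⟩ := hf l hl
  exact headSum_psi_le_of_lower hc hle t

omit [Valued K ℤᵐ⁰] in
/-- **Top data multiply in `R[ℤⁿ × ℤ]`**: if the exponents `(μ, c)` of `f` (resp. `g`) have `c = m` and `μ ≤ b` (resp. `c = m'`,
`μ ≤ b'`) with coefficient `1` at `x^{(b, m)}` (resp. `x^{(b', m')}`), then those of `f g` have `c = m + m'`, `μ ≤ b + b'`, and the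
coefficient of `x^{(b + b', m + m')}` is `1` (through `N` and `GLnSphericalHeckeAlgebraLeadingTerms` §1 in `ℤ^{n+2}`).
[cite: Macdonald1995, Ch. V (2.6)] [cite: CartierCorvallis1979, §IV, proof of Thm. 4.1 (c)] [cite: AndrianovZhuravlev1995, Ch. 3 §3.3 Thm. 3.30] -/
theorem forall_lower_and_coeff_mul_of_top_similitude {f g : AddMonoidAlgebra R ((Fin n → ℤ) × ℤ)} {b b' : Fin n → ℤ} {m m' : ℤ}
    (hf : (∀ μc, f.coeff μc ≠ 0 → μc.2 = m ∧
      ∀ s : ℕ, (∑ i : Fin n, if (i : ℕ) < s then μc.1 i else 0) ≤ ∑ i : Fin n, if (i : ℕ) < s then b i else 0) ∧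
      f.coeff (b, m) = 1)
    (hg : (∀ μc, g.coeff μc ≠ 0 → μc.2 = m' ∧
      ∀ s : ℕ, (∑ i : Fin n, if (i : ℕ) < s then μc.1 i else 0) ≤ ∑ i : Fin n, if (i : ℕ) < s then b' i else 0) ∧
      g.coeff (b', m') = 1) :
    (∀ μc, (f * g).coeff μc ≠ 0 → μc.2 = m + m' ∧
      ∀ s : ℕ, (∑ i : Fin n, if (i : ℕ) < s then μc.1 i else 0) ≤ ∑ i : Fin n, if (i : ℕ) < s then (b + b') i else 0) ∧
      (f * g).coeff (b + b', m + m') = 1 := by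
  have hf' := forall_headSum_psi_le_of_coeff_mapDomain_ne_zero (R := R) hf.1
  have hg' := forall_headSum_psi_le_of_coeff_mapDomain_ne_zero (R := R) hg.1
  have hadd : ((b + b', m + m') : (Fin n → ℤ) × ℤ) = (b, m) + (b', m') := rfl
  refine ⟨fun μc hμ => ?_, ?_⟩
  · rw [← coeff_mapDomain_psi_apply (R := R) _ μc, map_mul] at hμ
    have h := forall_sum_ite_lt_le_of_coeff_mul_ne_zero hf' hg' hμ
    rw [← map_add, ← hadd] at h
    exact lower_of_headSum_psi_le h
  · rw [← coeff_mapDomain_psi_apply (R := R) _ ((b + b', m + m')), map_mul, hadd, map_add,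
      coeff_mul_add_eq_mul_coeff_of_forall_sum_ite_lt_le hf' hg', coeff_mapDomain_psi_apply, coeff_mapDomain_psi_apply,
      hf.2, hg.2, mul_one]


/-! ## §2 Torus elements; top data of `𝒮_1(T_{t(m,a)})` -/

omit [Valued K ℤᵐ⁰] in
/-- **`t(m, a) t(m', a') = t(m + m', a + a')`.** [cite: AndrianovZhuravlev1995, Ch. 3 §3 Lemma 3.6] -/
theorem similitudeTorusElt_mul (hϖ0 : ϖ ≠ 0) (m m' : ℤ) (a a' : Fin n → ℤ) :
    (similitudeTorusElt hϖ0 m a : symplecticSimilitudeGroup (Fin n) K) * similitudeTorusElt hϖ0 m' a' =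
      similitudeTorusElt hϖ0 (m + m') (a + a') := by
  refine Subtype.ext (Units.ext ?_)
  rw [Subgroup.coe_mul, Units.val_mul, coe_coe_similitudeTorusElt, coe_coe_similitudeTorusElt, coe_coe_similitudeTorusElt,
    Matrix.diagonal_mul_diagonal]
  congr 1
  funext x
  rcases x with i | i
  · simp only [Sum.elim_inl, Pi.add_apply]
    rw [mul_mul_mul_comm, ← zpow_add₀ hϖ0, ← zpow_add₀ hϖ0]
  · simp only [Sum.elim_inr, Pi.add_apply]
    rw [← zpow_add₀ hϖ0, neg_add]

omit [Valued K ℤᵐ⁰] in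
/-- `t(0, 0) = 1`. [cite: AndrianovZhuravlev1995, Ch. 3 §3 Lemma 3.6] -/
theorem similitudeTorusElt_zero (hϖ0 : ϖ ≠ 0) :
    (similitudeTorusElt hϖ0 0 (0 : Fin n → ℤ) : symplecticSimilitudeGroup (Fin n) K) = 1 := by
  refine Subtype.ext (Units.ext ?_)
  rw [coe_coe_similitudeTorusElt, OneMemClass.coe_one, Units.val_one, ← Matrix.diagonal_one]
  congr 1
  funext x
  rcases x with i | i
  · simp only [Sum.elim_inl, Pi.zero_apply, zpow_zero, mul_one]
  · simp only [Sum.elim_inr, Pi.zero_apply, neg_zero, zpow_zero]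

omit [Valued K ℤᵐ⁰] in
/-- Sums of dominant torus data are dominant. [cite: BruhatTits1972, §4.4 (4.4.3)] -/
theorem dominant_add {m m' : ℤ} {a a' : Fin n → ℤ} (ha : Antitone a) (hm : ∀ i, 0 ≤ m + 2 * a i) (ha' : Antitone a')
    (hm' : ∀ i, 0 ≤ m' + 2 * a' i) : Antitone (a + a') ∧ ∀ i, 0 ≤ (m + m') + 2 * (a + a') i :=
  ⟨ha.add ha', fun i => by have h1 := hm i; have h2 := hm' i; simp only [Pi.add_apply]; linarith⟩

omit [Valued K ℤᵐ⁰] in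
/-- The sum of a list of dominant torus data is dominant. [cite: BruhatTits1972, §4.4 (4.4.3)] -/
theorem dominant_list_sum (L : List {d : ℤ × (Fin n → ℤ) // Antitone d.2 ∧ ∀ i, 0 ≤ d.1 + 2 * d.2 i}) :
    Antitone (L.map Subtype.val).sum.2 ∧ ∀ i, 0 ≤ (L.map Subtype.val).sum.1 + 2 * (L.map Subtype.val).sum.2 i := by
  induction L with
  | nil =>
    rw [List.map_nil, List.sum_nil]
    exact ⟨fun _ _ _ => le_rfl, fun i => by simp⟩
  | cons d L ih =>
    rw [List.map_cons, List.sum_cons, Prod.snd_add, Prod.fst_add]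
    exact dominant_add d.2.1 d.2.2 ih.1 ih.2

variable [NeZero n] [IsHeckeTriple (⊤ : Submonoid (symplecticSimilitudeGroup (Fin n) K)) (symplecticSimilitudeInt (Fin n) K)
  (symplecticSimilitudeInt (Fin n) K)]

/-- **Top data of the counting transform `𝒮_1(T_{t(m,a)})`** (`a` antitone, `m + 2aᵢ ≥ 0`): every exponent `(μ, c)` has
`c = m` and `μ ≤ m + a` (dominance), and the coefficient of `x^{(m + a, m)}` is `1` (g43-#9).
[cite: BruhatTits1972, Prop. (4.4.4) (i), (ii)] [cite: AndrianovZhuravlev1995, Ch. 3 §3.3 (3.44)–(3.46)] -/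
theorem similitudeSatakeTransform_one_top_data (hϖ : Valued.v ϖ = WithZero.exp (-1 : ℤ)) {m : ℤ} {a : Fin n → ℤ}
    (ha : Antitone a) (hm : ∀ i, 0 ≤ m + 2 * a i) :
    (∀ μc, (similitudeSatakeTransform hϖ (1 : Rˣ) (heckeAlgebra.doubleCosetOperator (k := R) (symplecticSimilitudeInt (Fin n) K)
          (similitudeTorusElt (uniformizer_ne_zero hϖ) m a : symplecticSimilitudeGroup (Fin n) K))).coeff μc ≠ 0 →
        μc.2 = m ∧ ∀ s : ℕ, (∑ i : Fin n, if (i : ℕ) < s then μc.1 i else 0) ≤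
          ∑ i : Fin n, if (i : ℕ) < s then (fun i => m + a i) i else 0) ∧
      (similitudeSatakeTransform hϖ (1 : Rˣ) (heckeAlgebra.doubleCosetOperator (k := R) (symplecticSimilitudeInt (Fin n) K)
          (similitudeTorusElt (uniformizer_ne_zero hϖ) m a : symplecticSimilitudeGroup (Fin n) K))).coeff (fun i => m + a i, m) = 1 := by
  refine ⟨fun μc hμ => ⟨snd_eq_of_coeff_similitudeSatakeTransform_ne_zero hϖ 1 m a hμ, fun s =>
    headSum_le_of_coeff_similitudeSatakeTransform_ne_zero hϖ 1 ha hm hμ s⟩, ?_⟩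
  rw [coeff_self_similitudeSatakeTransform_torusElt hϖ 1 ha hm, _root_.one_zpow, Units.val_one]

/-! ## §3 Every `T` is a combination of the `T_{t(m,a)}`; THE ENGINE -/

/-- **Every `T ∈ ℋ(GSp_{2n}(K), GSp_{2n}(𝒪); R)` is an `R`-combination of the `T_{t(m,a)}`, `a` antitone, `m + 2aᵢ ≥ 0`**
(double-coset spanning and the Cartan decomposition). [cite: AndrianovZhuravlev1995, Ch. 3 §3 Lemma 3.6] [cite: ShimuraIATAF1971, Prop. 3.1] -/
theorem mem_span_doubleCosetOperator_dominant_similitude (hϖ : Valued.v ϖ = WithZero.exp (-1 : ℤ))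
    (T : heckeAlgebra R (symplecticSimilitudeGroup (Fin n) K) (symplecticSimilitudeInt (Fin n) K)) :
    T ∈ Submodule.span R (Set.range fun d : {d : ℤ × (Fin n → ℤ) // Antitone d.2 ∧ ∀ i, 0 ≤ d.1 + 2 * d.2 i} =>
      heckeAlgebra.doubleCosetOperator (k := R) (symplecticSimilitudeInt (Fin n) K)
          (similitudeTorusElt (uniformizer_ne_zero hϖ) d.1.1 d.1.2 : symplecticSimilitudeGroup (Fin n) K)) := by
  refine (Submodule.span_le.2 ?_) (heckeAlgebra.mem_span_doubleCosetOperator (k := R) (symplecticSimilitudeInt (Fin n) K) T)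
  rintro _ ⟨γ, -, rfl⟩
  obtain ⟨m, a, ha, hm, horb⟩ := exists_dominant_similitudeTorusElt_mem_orbit hϖ
    (γ.out : symplecticSimilitudeGroup (Fin n) K ⧸ symplecticSimilitudeInt (Fin n) K)
  rw [QuotientGroup.out_eq'] at horb
  have horb' : (γ.out : symplecticSimilitudeGroup (Fin n) K ⧸ symplecticSimilitudeInt (Fin n) K) ∈
      MulAction.orbit (symplecticSimilitudeInt (Fin n) K)
        ((similitudeTorusElt (uniformizer_ne_zero hϖ) m a : symplecticSimilitudeGroup (Fin n) K) :
          symplecticSimilitudeGroup (Fin n) K ⧸ symplecticSimilitudeInt (Fin n) K) := by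
    rw [QuotientGroup.out_eq', ← MulAction.orbit_eq_iff, MulAction.orbit_eq_iff.2 horb]
  change heckeAlgebra.doubleCosetOperator (k := R) (symplecticSimilitudeInt (Fin n) K) γ.out ∈ _
  rw [heckeAlgebra.doubleCosetOperator_eq_of_mem_orbit (symplecticSimilitudeInt (Fin n) K) horb']
  exact Submodule.subset_span ⟨⟨(m, a), ha, hm⟩, rfl⟩

/-- **THE ENGINE** (`GSp_{2n}` version of `exists_finsupp_eq_sum_of_coeff_satakeTransform_one`): if every exponent
`(μ, c)` of the counting transform `𝒮_1(T)` has `c = m₀` and `μ ≤ m₀ + a₀` (`a₀` antitone, `m₀ + 2a₀ᵢ ≥ 0`) and the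
coefficient of `x^{(m₀ + a₀, m₀)}` is `1`, then `T = ∑ l_{(m,a)} T_{t(m,a)}` over dominant `(m, a)` with `m = m₀`,
`m + a ≤ m₀ + a₀`, and `l_{(m₀,a₀)} = 1` — the abstract support lemmas of `GLnSphericalHeckeAlgebraIntegralGenerators` §1 in
`ℤ^{n+2}` applied to the family `(m, a) ↦ N 𝒮_1(T_{t(m,a)})` (bottoms `ψ(m + a, m)`, bottom coefficients `1`).
[cite: CartierCorvallis1979, §IV, proof of Thm. 4.1 (c)] [cite: Macdonald1995, Ch. V (2.6)] [cite: AndrianovZhuravlev1995, Ch. 3 §3 Lemma 3.6, §3.3 Thm. 3.30] -/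
theorem exists_finsupp_eq_sum_of_coeff_similitudeSatakeTransform_one (hϖ : Valued.v ϖ = WithZero.exp (-1 : ℤ))
    {T : heckeAlgebra R (symplecticSimilitudeGroup (Fin n) K) (symplecticSimilitudeInt (Fin n) K)} {m₀ : ℤ} {a₀ : Fin n → ℤ}
    (ha₀ : Antitone a₀) (hm₀ : ∀ i, 0 ≤ m₀ + 2 * a₀ i)
    (htri : ∀ μc, (similitudeSatakeTransform hϖ (1 : Rˣ) T).coeff μc ≠ 0 →
      μc.2 = m₀ ∧ ∀ s : ℕ, (∑ i : Fin n, if (i : ℕ) < s then μc.1 i else 0) ≤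
        ∑ i : Fin n, if (i : ℕ) < s then (fun i => m₀ + a₀ i) i else 0)
    (hlead : (similitudeSatakeTransform hϖ (1 : Rˣ) T).coeff (fun i => m₀ + a₀ i, m₀) = 1) :
    ∃ l : {d : ℤ × (Fin n → ℤ) // Antitone d.2 ∧ ∀ i, 0 ≤ d.1 + 2 * d.2 i} →₀ R,
      (∀ d ∈ l.support, d.1.1 = m₀ ∧ ∀ s : ℕ, (∑ i : Fin n, if (i : ℕ) < s then (fun i => d.1.1 + d.1.2 i) i else 0) ≤
        ∑ i : Fin n, if (i : ℕ) < s then (fun i => m₀ + a₀ i) i else 0) ∧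
      l ⟨(m₀, a₀), ha₀, hm₀⟩ = 1 ∧
      T = ∑ d ∈ l.support, l d • heckeAlgebra.doubleCosetOperator (k := R) (symplecticSimilitudeInt (Fin n) K)
          (similitudeTorusElt (uniformizer_ne_zero hϖ) d.1.1 d.1.2 : symplecticSimilitudeGroup (Fin n) K) := by
  classical
  set S := similitudeSatakeTransform (n := n) (R := R) hϖ (1 : Rˣ) with hS
  set Nw := AddMonoidAlgebra.mapDomainAlgHom R R (LinearMap.pi (Matrix.vecCons (-LinearMap.snd ℤ (Fin n → ℤ) ℤ)
        (Matrix.vecCons ((2 : ℤ) • LinearMap.snd ℤ (Fin n → ℤ) ℤ)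
          fun i : Fin n => -((LinearMap.proj i).comp (LinearMap.fst ℤ (Fin n → ℤ) ℤ)))) :
        ((Fin n → ℤ) × ℤ) →ₗ[ℤ] (Fin (n + 2) → ℤ)).toAddMonoidHom with hNw
  set c : {d : ℤ × (Fin n → ℤ) // Antitone d.2 ∧ ∀ i, 0 ≤ d.1 + 2 * d.2 i} → heckeAlgebra R (symplecticSimilitudeGroup (Fin n) K) (symplecticSimilitudeInt (Fin n) K) :=
    fun d => heckeAlgebra.doubleCosetOperator (k := R) (symplecticSimilitudeInt (Fin n) K)
          (similitudeTorusElt (uniformizer_ne_zero hϖ) d.1.1 d.1.2 : symplecticSimilitudeGroup (Fin n) K) with hc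
  set bot : {d : ℤ × (Fin n → ℤ) // Antitone d.2 ∧ ∀ i, 0 ≤ d.1 + 2 * d.2 i} → Fin (n + 2) → ℤ := fun d => (LinearMap.pi (Matrix.vecCons (-LinearMap.snd ℤ (Fin n → ℤ) ℤ)
        (Matrix.vecCons ((2 : ℤ) • LinearMap.snd ℤ (Fin n → ℤ) ℤ)
          fun i : Fin n => -((LinearMap.proj i).comp (LinearMap.fst ℤ (Fin n → ℤ) ℤ)))) :
        ((Fin n → ℤ) × ℤ) →ₗ[ℤ] (Fin (n + 2) → ℤ)) (fun i => d.1.1 + d.1.2 i, d.1.1) with hbot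
  obtain ⟨l, hlT⟩ := (Finsupp.mem_span_range_iff_exists_finsupp).1 (mem_span_doubleCosetOperator_dominant_similitude (R := R) hϖ T)
  have hlT' : T = ∑ d ∈ l.support, l d • c d := by rw [← hlT, Finsupp.sum]
  have hST : (∑ d ∈ l.support, l d • Nw (S (c d))) = Nw (S T) := by
    rw [hlT', map_sum, map_sum]
    exact Finset.sum_congr rfl fun d _ => by rw [map_smul, map_smul]
  -- bottom data of the twisted family `d ↦ N 𝒮_1(c_d)`: bottoms `ψ(m + a, m)`, coefficient `1`
  have hsupp : ∀ d ∈ insert (⟨(m₀, a₀), ha₀, hm₀⟩ : {d : ℤ × (Fin n → ℤ) // Antitone d.2 ∧ ∀ i, 0 ≤ d.1 + 2 * d.2 i}) l.support, ∀ v, (Nw (S (c d))).coeff v ≠ 0 →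
      ∀ t : ℕ, (∑ j : Fin (n + 2), if (j : ℕ) < t then bot d j else 0) ≤ ∑ j : Fin (n + 2), if (j : ℕ) < t then v j else 0 :=
    fun d _ v hv t => forall_headSum_psi_le_of_coeff_mapDomain_ne_zero
      (similitudeSatakeTransform_one_top_data (R := R) hϖ d.2.1 d.2.2).1 v hv t
  have hlead' : ∀ d ∈ l.support, IsUnit ((Nw (S (c d))).coeff (bot d)) := fun d _ => by
    rw [hbot, hNw, coeff_mapDomain_psi_apply, (similitudeSatakeTransform_one_top_data (R := R) hϖ d.2.1 d.2.2).2]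
    exact isUnit_one
  have hinj : Set.InjOn bot ↑(insert (⟨(m₀, a₀), ha₀, hm₀⟩ : {d : ℤ × (Fin n → ℤ) // Antitone d.2 ∧ ∀ i, 0 ≤ d.1 + 2 * d.2 i}) l.support) := fun d _ d' _ h => by
    have h' := psi_injective h
    simp only [Prod.mk.injEq] at h'
    obtain ⟨h1, h2⟩ := h'
    refine Subtype.ext (Prod.ext h2 (funext fun i => ?_))
    have hi := congrFun h1 i
    rw [h2] at hi
    exact add_left_cancel hi
  have hXtri : ∀ v, (∑ d ∈ l.support, l d • Nw (S (c d))).coeff v ≠ 0 →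
      ∀ t : ℕ, (∑ j : Fin (n + 2), if (j : ℕ) < t then (LinearMap.pi (Matrix.vecCons (-LinearMap.snd ℤ (Fin n → ℤ) ℤ)
        (Matrix.vecCons ((2 : ℤ) • LinearMap.snd ℤ (Fin n → ℤ) ℤ)
          fun i : Fin n => -((LinearMap.proj i).comp (LinearMap.fst ℤ (Fin n → ℤ) ℤ)))) :
        ((Fin n → ℤ) × ℤ) →ₗ[ℤ] (Fin (n + 2) → ℤ)) (fun i => m₀ + a₀ i, m₀) j else 0) ≤
        ∑ j : Fin (n + 2), if (j : ℕ) < t then v j else 0 := by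
    rw [hST]
    exact fun v hv t => forall_headSum_psi_le_of_coeff_mapDomain_ne_zero htri v hv t
  -- every `d` of the support has `bot d` above `ψ(m₀ + a₀, m₀)`
  have habove : ∀ d ∈ l.support, ∀ t : ℕ,
      (∑ j : Fin (n + 2), if (j : ℕ) < t then (LinearMap.pi (Matrix.vecCons (-LinearMap.snd ℤ (Fin n → ℤ) ℤ)
        (Matrix.vecCons ((2 : ℤ) • LinearMap.snd ℤ (Fin n → ℤ) ℤ)
          fun i : Fin n => -((LinearMap.proj i).comp (LinearMap.fst ℤ (Fin n → ℤ) ℤ)))) :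
        ((Fin n → ℤ) × ℤ) →ₗ[ℤ] (Fin (n + 2) → ℤ)) (fun i => m₀ + a₀ i, m₀) j else 0) ≤
        ∑ j : Fin (n + 2), if (j : ℕ) < t then bot d j else 0 := fun d hd t =>
    forall_sum_ite_lt_le_of_coeff_sum_smul_ne_zero l.support (fun d => l d) (fun d => Nw (S (c d))) bot
      (fun d hd d' hd' h => hinj (Finset.mem_insert_of_mem hd) (Finset.mem_insert_of_mem hd') h)
      (fun d hd => hsupp d (Finset.mem_insert_of_mem hd)) hlead' _ hXtri hd (Finsupp.mem_support_iff.1 hd) t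
  -- the coefficient `l_{(m₀, a₀)}`
  have hsum' : (∑ d ∈ insert (⟨(m₀, a₀), ha₀, hm₀⟩ : {d : ℤ × (Fin n → ℤ) // Antitone d.2 ∧ ∀ i, 0 ≤ d.1 + 2 * d.2 i}) l.support, l d • Nw (S (c d))) =
      ∑ d ∈ l.support, l d • Nw (S (c d)) :=
    Finset.sum_insert_of_eq_zero_if_notMem fun h => by rw [Finsupp.notMem_support_iff.1 h, zero_smul]
  have hcoef := coeff_sum_smul_eq_mul_of_forall_le (insert (⟨(m₀, a₀), ha₀, hm₀⟩ : {d : ℤ × (Fin n → ℤ) // Antitone d.2 ∧ ∀ i, 0 ≤ d.1 + 2 * d.2 i}) l.support)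
    (fun d => l d) (fun d => Nw (S (c d))) bot hinj hsupp (Finset.mem_insert_self _ _)
    (fun d hd _ t => by
      rcases Finset.mem_insert.1 hd with rfl | hd
      · exact le_rfl
      · exact habove d hd t)
  rw [hsum', hST] at hcoef
  change (Nw (S T)).coeff (bot ⟨(m₀, a₀), ha₀, hm₀⟩) =
    l ⟨(m₀, a₀), ha₀, hm₀⟩ * (Nw (S (c ⟨(m₀, a₀), ha₀, hm₀⟩))).coeff (bot ⟨(m₀, a₀), ha₀, hm₀⟩) at hcoef
  rw [hbot, hNw, coeff_mapDomain_psi_apply, coeff_mapDomain_psi_apply] at hcoef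
  change (S T).coeff (fun i => m₀ + a₀ i, m₀) = l ⟨(m₀, a₀), ha₀, hm₀⟩ * (S (c ⟨(m₀, a₀), ha₀, hm₀⟩)).coeff (fun i => m₀ + a₀ i, m₀)
    at hcoef
  rw [hlead, (similitudeSatakeTransform_one_top_data (R := R) hϖ ha₀ hm₀).2, mul_one] at hcoef
  refine ⟨l, fun d hd => ?_, hcoef.symm, hlT'⟩
  exact lower_of_headSum_psi_le (habove d hd)

/-! ## §4 Products of Cartan double cosets of `GSp_{2n}` are unitriangular -/

omit [NeZero n] [IsHeckeTriple (⊤ : Submonoid (symplecticSimilitudeGroup (Fin n) K)) (symplecticSimilitudeInt (Fin n) K)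
  (symplecticSimilitudeInt (Fin n) K)] in
/-- The top exponent is additive: `(m + m') + (a + a') = (m + a) + (m' + a')`. [folklore] -/
private theorem top_add (m m' : ℤ) (a a' : Fin n → ℤ) :
    (fun i => (m + m') + (a + a') i) = (fun i => m + a i) + fun i => m' + a' i := by
  funext i
  simp only [Pi.add_apply]
  ring

omit [IsHeckeTriple (⊤ : Submonoid (symplecticSimilitudeGroup (Fin n) K)) (symplecticSimilitudeInt (Fin n) K)
  (symplecticSimilitudeInt (Fin n) K)] in
/-- **Top data multiply for the similitude counting transform**. [cite: Macdonald1995, Ch. V (2.6)]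
[cite: CartierCorvallis1979, §IV, proof of Thm. 4.1 (c)] -/
theorem similitudeSatakeTransform_one_mul_top_data (hϖ : Valued.v ϖ = WithZero.exp (-1 : ℤ))
    {T₁ T₂ : heckeAlgebra R (symplecticSimilitudeGroup (Fin n) K) (symplecticSimilitudeInt (Fin n) K)} {m m' : ℤ}
    {a a' : Fin n → ℤ}
    (h₁ : (∀ μc, (similitudeSatakeTransform hϖ (1 : Rˣ) T₁).coeff μc ≠ 0 →
        μc.2 = m ∧ ∀ s : ℕ, (∑ i : Fin n, if (i : ℕ) < s then μc.1 i else 0) ≤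
          ∑ i : Fin n, if (i : ℕ) < s then (fun i => m + a i) i else 0) ∧
      (similitudeSatakeTransform hϖ (1 : Rˣ) T₁).coeff (fun i => m + a i, m) = 1)
    (h₂ : (∀ μc, (similitudeSatakeTransform hϖ (1 : Rˣ) T₂).coeff μc ≠ 0 →
        μc.2 = m' ∧ ∀ s : ℕ, (∑ i : Fin n, if (i : ℕ) < s then μc.1 i else 0) ≤
          ∑ i : Fin n, if (i : ℕ) < s then (fun i => m' + a' i) i else 0) ∧
      (similitudeSatakeTransform hϖ (1 : Rˣ) T₂).coeff (fun i => m' + a' i, m') = 1) :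
    (∀ μc, (similitudeSatakeTransform hϖ (1 : Rˣ) (T₁ * T₂)).coeff μc ≠ 0 →
        μc.2 = m + m' ∧ ∀ s : ℕ, (∑ i : Fin n, if (i : ℕ) < s then μc.1 i else 0) ≤
          ∑ i : Fin n, if (i : ℕ) < s then (fun i => (m + m') + (a + a') i) i else 0) ∧
      (similitudeSatakeTransform hϖ (1 : Rˣ) (T₁ * T₂)).coeff (fun i => (m + m') + (a + a') i, m + m') = 1 := by
  rw [map_mul, top_add]
  exact forall_lower_and_coeff_mul_of_top_similitude h₁ h₂

/-- **PRODUCTS OF CARTAN DOUBLE COSETS OF `GSp_{2n}` ARE UNITRIANGULAR, OVER ANY COMMUTATIVE RING `R`**: for dominant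
`(m, a)`, `(m', a')`, `T_{t(m,a)} T_{t(m',a')} = ∑_ν l_ν T_{t(ν)}` over dominant `ν = (m + m', b)` with `b ≤ a + a'`
(dominance) and `l_{(m+m', a+a')} = 1` — Andrianov–Zhuravlev's triangularity of the multiplication table of the local Hecke
ring of the symplectic group; Cartier's step (c) for `GSp_{2n}`.
[cite: AndrianovZhuravlev1995, Ch. 3 §3 Lemma 3.6, §3.3 Thm. 3.30] [cite: CartierCorvallis1979, §IV, proof of Thm. 4.1 (c)]
[cite: Macdonald1995, Ch. V (2.6)] -/
theorem exists_finsupp_doubleCosetOperator_mul_eq_sum_similitude (hϖ : Valued.v ϖ = WithZero.exp (-1 : ℤ)) {m m' : ℤ}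
    {a a' : Fin n → ℤ} (ha : Antitone a) (hm : ∀ i, 0 ≤ m + 2 * a i) (ha' : Antitone a') (hm' : ∀ i, 0 ≤ m' + 2 * a' i) :
    ∃ l : {d : ℤ × (Fin n → ℤ) // Antitone d.2 ∧ ∀ i, 0 ≤ d.1 + 2 * d.2 i} →₀ R,
      (∀ ν ∈ l.support, ν.1.1 = m + m' ∧
        ∀ s : ℕ, (∑ i : Fin n, if (i : ℕ) < s then (fun i => ν.1.1 + ν.1.2 i) i else 0) ≤
          ∑ i : Fin n, if (i : ℕ) < s then (fun i => (m + m') + (a + a') i) i else 0) ∧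
      l ⟨(m + m', a + a'), dominant_add ha hm ha' hm'⟩ = 1 ∧
      heckeAlgebra.doubleCosetOperator (k := R) (symplecticSimilitudeInt (Fin n) K)
          (similitudeTorusElt (uniformizer_ne_zero hϖ) m a : symplecticSimilitudeGroup (Fin n) K) *
          heckeAlgebra.doubleCosetOperator (k := R) (symplecticSimilitudeInt (Fin n) K)
          (similitudeTorusElt (uniformizer_ne_zero hϖ) m' a' : symplecticSimilitudeGroup (Fin n) K) =
        ∑ ν ∈ l.support, l ν • heckeAlgebra.doubleCosetOperator (k := R) (symplecticSimilitudeInt (Fin n) K)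
          (similitudeTorusElt (uniformizer_ne_zero hϖ) ν.1.1 ν.1.2 : symplecticSimilitudeGroup (Fin n) K) := by
  obtain ⟨htri, hlead⟩ := similitudeSatakeTransform_one_mul_top_data hϖ
    (similitudeSatakeTransform_one_top_data (R := R) hϖ ha hm) (similitudeSatakeTransform_one_top_data (R := R) hϖ ha' hm')
  exact exists_finsupp_eq_sum_of_coeff_similitudeSatakeTransform_one hϖ (ha.add ha') (dominant_add ha hm ha' hm').2 htri hlead

/-- **`T_{t(m,a)} T_{t(m',a')} = T_{t(m+m', a+a')} + ∑_{ν ≠ (m+m', a+a')} l_ν T_{t(ν)}`** with every `ν = (m + m', b)`, `b ≤ a + a'`: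
the leading term split off (any `R`). [cite: AndrianovZhuravlev1995, Ch. 3 §3.3 Thm. 3.30] [cite: CartierCorvallis1979, §IV, proof of Thm. 4.1 (c)] -/
theorem doubleCosetOperator_mul_eq_add_sum_similitude (hϖ : Valued.v ϖ = WithZero.exp (-1 : ℤ)) {m m' : ℤ}
    {a a' : Fin n → ℤ} (ha : Antitone a) (hm : ∀ i, 0 ≤ m + 2 * a i) (ha' : Antitone a') (hm' : ∀ i, 0 ≤ m' + 2 * a' i) :
    ∃ l : {d : ℤ × (Fin n → ℤ) // Antitone d.2 ∧ ∀ i, 0 ≤ d.1 + 2 * d.2 i} →₀ R,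
      (∀ ν ∈ l.support.erase ⟨(m + m', a + a'), dominant_add ha hm ha' hm'⟩, ν.1 ≠ (m + m', a + a') ∧ ν.1.1 = m + m' ∧
        ∀ s : ℕ, (∑ i : Fin n, if (i : ℕ) < s then (fun i => ν.1.1 + ν.1.2 i) i else 0) ≤
          ∑ i : Fin n, if (i : ℕ) < s then (fun i => (m + m') + (a + a') i) i else 0) ∧
      heckeAlgebra.doubleCosetOperator (k := R) (symplecticSimilitudeInt (Fin n) K)
          (similitudeTorusElt (uniformizer_ne_zero hϖ) m a : symplecticSimilitudeGroup (Fin n) K) *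
          heckeAlgebra.doubleCosetOperator (k := R) (symplecticSimilitudeInt (Fin n) K)
          (similitudeTorusElt (uniformizer_ne_zero hϖ) m' a' : symplecticSimilitudeGroup (Fin n) K) =
        heckeAlgebra.doubleCosetOperator (k := R) (symplecticSimilitudeInt (Fin n) K)
          (similitudeTorusElt (uniformizer_ne_zero hϖ) (m + m') (a + a') : symplecticSimilitudeGroup (Fin n) K) +
          ∑ ν ∈ l.support.erase ⟨(m + m', a + a'), dominant_add ha hm ha' hm'⟩, l ν •
            heckeAlgebra.doubleCosetOperator (k := R) (symplecticSimilitudeInt (Fin n) K)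
          (similitudeTorusElt (uniformizer_ne_zero hϖ) ν.1.1 ν.1.2 : symplecticSimilitudeGroup (Fin n) K) := by
  classical
  obtain ⟨l, hl, hla, hprod⟩ := exists_finsupp_doubleCosetOperator_mul_eq_sum_similitude (R := R) hϖ ha hm ha' hm'
  refine ⟨l, fun ν hν => ?_, ?_⟩
  · obtain ⟨hne, hν⟩ := Finset.mem_erase.1 hν
    exact ⟨fun h => hne (Subtype.ext h), hl ν hν⟩
  · rw [hprod]
    by_cases hmem : (⟨(m + m', a + a'), dominant_add ha hm ha' hm'⟩ : {d : ℤ × (Fin n → ℤ) // Antitone d.2 ∧ ∀ i, 0 ≤ d.1 + 2 * d.2 i}) ∈ l.support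
    · rw [← Finset.add_sum_erase _ _ hmem, hla, one_smul]
    · have h0 : l ⟨(m + m', a + a'), dominant_add ha hm ha' hm'⟩ = 0 := Finsupp.notMem_support_iff.1 hmem
      rw [hla] at h0
      have hR : ∀ x : heckeAlgebra R (symplecticSimilitudeGroup (Fin n) K) (symplecticSimilitudeInt (Fin n) K), x = 0 :=
        fun x => by rw [← one_smul R x, h0, zero_smul]
      rw [hR (∑ ν ∈ l.support, _), hR (_ + _)]

/-- **A PRODUCT `T_{t(d_1)} ⋯ T_{t(d_k)}` IS `T_{t(d_1 + ⋯ + d_k)} +` LOWER TERMS** (any `R`): for a list of dominant torus data,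
`∏ T_{t(d_j)} = ∑_ν l_ν T_{t(ν)}` with `l_{Σ d_j} = 1`, every `ν` of the support having the multiplier exponent of `Σ d_j` and
`ν ≤ Σ d_j`. [cite: AndrianovZhuravlev1995, Ch. 3 §3.3 Thm. 3.30] [cite: Macdonald1995, Ch. II (2.3), Ch. V (2.6)] -/
theorem exists_finsupp_list_prod_doubleCosetOperator_eq_sum_similitude (hϖ : Valued.v ϖ = WithZero.exp (-1 : ℤ))
    (L : List {d : ℤ × (Fin n → ℤ) // Antitone d.2 ∧ ∀ i, 0 ≤ d.1 + 2 * d.2 i}) :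
    ∃ l : {d : ℤ × (Fin n → ℤ) // Antitone d.2 ∧ ∀ i, 0 ≤ d.1 + 2 * d.2 i} →₀ R,
      (∀ ν ∈ l.support, ν.1.1 = (L.map Subtype.val).sum.1 ∧
        ∀ s : ℕ, (∑ i : Fin n, if (i : ℕ) < s then (fun i => ν.1.1 + ν.1.2 i) i else 0) ≤
          ∑ i : Fin n, if (i : ℕ) < s then (fun i => (L.map Subtype.val).sum.1 + (L.map Subtype.val).sum.2 i) i else 0) ∧
      l ⟨(L.map Subtype.val).sum, dominant_list_sum L⟩ = 1 ∧
      (L.map fun d : {d : ℤ × (Fin n → ℤ) // Antitone d.2 ∧ ∀ i, 0 ≤ d.1 + 2 * d.2 i} =>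
          heckeAlgebra.doubleCosetOperator (k := R) (symplecticSimilitudeInt (Fin n) K)
          (similitudeTorusElt (uniformizer_ne_zero hϖ) d.1.1 d.1.2 : symplecticSimilitudeGroup (Fin n) K)).prod =
        ∑ ν ∈ l.support, l ν • heckeAlgebra.doubleCosetOperator (k := R) (symplecticSimilitudeInt (Fin n) K)
          (similitudeTorusElt (uniformizer_ne_zero hϖ) ν.1.1 ν.1.2 : symplecticSimilitudeGroup (Fin n) K) := by
  -- top data of the product, by induction on the list
  have hdata : ∀ L : List {d : ℤ × (Fin n → ℤ) // Antitone d.2 ∧ ∀ i, 0 ≤ d.1 + 2 * d.2 i},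
      (∀ μc, (similitudeSatakeTransform hϖ (1 : Rˣ) (L.map fun d : {d : ℤ × (Fin n → ℤ) // Antitone d.2 ∧ ∀ i, 0 ≤ d.1 + 2 * d.2 i} =>
          heckeAlgebra.doubleCosetOperator (k := R) (symplecticSimilitudeInt (Fin n) K)
          (similitudeTorusElt (uniformizer_ne_zero hϖ) d.1.1 d.1.2 : symplecticSimilitudeGroup (Fin n) K)).prod).coeff μc ≠ 0 →
        μc.2 = (L.map Subtype.val).sum.1 ∧ ∀ s : ℕ, (∑ i : Fin n, if (i : ℕ) < s then μc.1 i else 0) ≤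
          ∑ i : Fin n, if (i : ℕ) < s then (fun i => (L.map Subtype.val).sum.1 + (L.map Subtype.val).sum.2 i) i else 0) ∧
      (similitudeSatakeTransform hϖ (1 : Rˣ) (L.map fun d : {d : ℤ × (Fin n → ℤ) // Antitone d.2 ∧ ∀ i, 0 ≤ d.1 + 2 * d.2 i} =>
          heckeAlgebra.doubleCosetOperator (k := R) (symplecticSimilitudeInt (Fin n) K)
          (similitudeTorusElt (uniformizer_ne_zero hϖ) d.1.1 d.1.2 : symplecticSimilitudeGroup (Fin n) K)).prod).coeff
        (fun i => (L.map Subtype.val).sum.1 + (L.map Subtype.val).sum.2 i, (L.map Subtype.val).sum.1) = 1 := by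
    intro L
    induction L with
    | nil =>
      have h := similitudeSatakeTransform_one_top_data (R := R) hϖ (show Antitone (0 : Fin n → ℤ) from fun _ _ _ => le_rfl)
        (m := 0) (fun i => by simp)
      rw [similitudeTorusElt_zero (uniformizer_ne_zero hϖ), heckeAlgebra.doubleCosetOperator_one] at h
      rw [List.map_nil, List.prod_nil, List.map_nil, List.sum_nil, Prod.fst_zero, Prod.snd_zero]
      exact h
    | cons d L ih =>
      rw [List.map_cons, List.prod_cons, List.map_cons, List.sum_cons, Prod.fst_add, Prod.snd_add]
      exact similitudeSatakeTransform_one_mul_top_data hϖ (similitudeSatakeTransform_one_top_data (R := R) hϖ d.2.1 d.2.2) ih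
  obtain ⟨htri, hlead⟩ := hdata L
  have h := exists_finsupp_eq_sum_of_coeff_similitudeSatakeTransform_one hϖ (dominant_list_sum L).1 (dominant_list_sum L).2
    htri hlead
  exact h

end Literature.NumberTheory.Automorphic.SymplecticCartan

end
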